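import Mathlib.Analysis.Distribution.FourierMultiplier
import Mathlib.Analysis.Distribution.TemperedDistribution
import Mathlib.MeasureTheory.Function.LpSpace.Basic
import Literature.Analysis.UnboundedOperators.StrongContRepresentation
import Literature.Analysis.UnboundedOperators.DiagonalOperator
import Literature.Analysis.UnboundedOperators.HeatKernel
import HarnessLib

-- provenance: harness21/H21/H21/Prelude/UnbddOp/HeatSemigroup.lean @ aa07551 (interim HEAD d8f2665); M5 mechanical rewrite
/-!
# The heat semigroup `e^{tΔ}` as a Fourier multiplier, and the torus heat multiplier

Trunk: `UnbddOp` (outline §C7b, notion `heat_semigroup`). This file is the *Fourier half* of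
the heat semigroup, complementing the kernel half in `Literature.Prelude.UnbddOp.HeatKernel`:

* `SchwartzMap.heatSemigroup t : 𝓢(E, F) →L[ℂ] 𝓢(E, F)`, the Fourier multiplier with symbol
  `Literature.heatSymbol t = exp (-(2π)² t ‖ξ‖²)` on Schwartz space;
* `TemperedDistribution.heatSemigroup t : 𝓢'(E, F) →L[ℂ] 𝓢'(E, F)`, the same multiplier on
  tempered distributions;
* the semigroup law, compatibility with the embedding `𝓢 → 𝓢'`, `d/dt e^{tΔ} u = Δ e^{tΔ} u`
  in `𝓢'`, commutation with `Δ`, the bridge to the caloric extension of an `L^p` function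
  (`heatSemigroup_toTemperedDistribution_Lp`), and existence of the associated C₀-semigroup;
* on the torus side, `Literature.torusHeatMultiplier d t ∈ ℓ^∞(ℤᵈ, ℂ)`, `n ↦ exp (-(2π)² t |n|²)`, and
  `HilbertBasis.torusHeatSemigroup b t = b.diagonalCLM (torusHeatMultiplier d t)`, the heat
  semigroup on any Hilbert space `X` carrying a Hilbert basis indexed by `ℤᵈ = d → ℤ` (e.g. the
  Fourier basis of `L²(𝕋ᵈ)`), with its contraction, eigenvector and self-adjointness API.

## Sources

* L. C. Evans, *Partial Differential Equations*, 2nd ed. (2010), §2.3 (heat equation).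
* E. M. Stein, G. Weiss, *Introduction to Fourier Analysis on Euclidean Spaces* (1971), Ch. I
  (Gauss–Weierstrass semigroup as a Fourier multiplier), Ch. VII (Fourier series on `𝕋ᵈ`).
* L. Grafakos, *Classical Fourier Analysis*, 3rd ed. (2014), §3 (Fourier series, heat kernel on
  the torus).
* K.-J. Engel, R. Nagel, *One-Parameter Semigroups for Linear Evolution Equations* (2000),
  Ch. II §2.13 (diffusion semigroup on `𝓢`, `L^p`).

## Mathlib

Used without redefinition: `SchwartzMap.fourierMultiplierCLM`,
`TemperedDistribution.fourierMultiplierCLM` (and their `_fourierMultiplierCLM_apply`, `_const`,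
`_toTemperedDistributionCLM_eq` lemmas), `SchwartzMap.laplacian_eq_fourierMultiplierCLM`,
`TemperedDistribution.laplacian_eq_fourierMultiplierCLM`, the `Laplacian` instances on `𝓢`, `𝓢'`,
`SchwartzMap.toTemperedDistributionCLM` (coercion `𝓢 → 𝓢'`), `MeasureTheory.Lp.toTemperedDistribution`
(coercion `Lp → 𝓢'`), `MeasureTheory.MemLp.toLp`, `lp`, `memℓp_infty`, `HilbertBasis`,
`IsSelfAdjoint`. Mathlib has no heat semigroup (searched `heat`, `Gauss–Weierstrass`, `semigroup`
in `Analysis/Distribution`, `Analysis/Fourier`, `Analysis/SpecialFunctions/Gaussian`).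
From H21: `heatSymbol`, `heatSymbol_hasTemperateGrowth`, `heatExtension`, `memLp_heatExtension`
(C7a), `HilbertBasis.diagonalCLM` and its API (C6), `C0Semigroup`, `C0Semigroup.app` (C3).

## Design choices

* **Interface fact for G12 (Navier–Stokes).** Mathlib's `fourierMultiplierCLM` on `𝓢(E, F)` and
  `𝓢'(E, F)` requires a *complex* normed space of values, `[NormedSpace ℂ F]`; hence so do
  `SchwartzMap.heatSemigroup` and `TemperedDistribution.heatSemigroup`. Real vector fields must
  be complexified (or handled through the kernel half `Literature.Analysis.UnboundedOperators.heatExtension`, which allows real `F`).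
  The real structure on `F` used by `𝓢(E, F)`, `heatExtension` and `HasDerivAt` below is the
  restriction of scalars `NormedSpace.complexToReal`.
* Time is `t : ℝ`. For `t < 0` the symbol `exp (-(2π)² t ‖ξ‖²)` is not of temperate growth, so
  `fourierMultiplierCLM` returns a junk value (Mathlib's `smulLeftCLM` is `0` for symbols without
  temperate growth); all API lemmas assume `0 ≤ t` (or `0 < t`).
* **No bundled `heatC0Semigroup` definition**: the strong-continuity field of `Literature.Analysis.UnboundedOperators.C0Semigroup`
  would require a real proof of continuity of `t ↦ e^{tΔ} f` in the Schwartz topology. Instead we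
  record the existence statements `SchwartzMap.exists_heatC0Semigroup E F`,
  `HilbertBasis.exists_torusHeatC0Semigroup b` as named facts (`def … : Prop`, no proof), and
  likewise `TemperedDistribution.hasDerivAt_heatSemigroup E F` and
  `MeasureTheory.Lp.heatSemigroup_toTemperedDistribution_Lp E F`.
* **Upstream named facts as hypotheses.** Temperate growth of the real heat symbol
  (`Literature.Analysis.UnboundedOperators.heatSymbol_hasTemperateGrowth`, hypothesis `hE`) and `L^p`-boundedness of the caloric
  extension (`Literature.Analysis.UnboundedOperators.memLp_heatExtension`, hypothesis `hM`) are `Prop`s in `HeatKernel`; every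
  lemma here that needs them takes them as explicit hypotheses.
* Declarations in the namespaces `SchwartzMap`, `TemperedDistribution`, `MeasureTheory.Lp` and
  `HilbertBasis` are deliberate dot-notation extensions of Mathlib's namespaces (each docstring
  says so), matching `HilbertBasis.diagonalCLM` in C6; `torusHeatMultiplier` lives in `Literature`.
* Torus time is `t : ℝ≥0` (the multiplier is bounded by `1` exactly for `0 ≤ t`, which is needed
  for membership in `ℓ^∞`).
-/

open MeasureTheory Filter Topology
open scoped Real ENNReal NNReal FourierTransform SchwartzMap Laplacian

noncomputable section

/-! ### The complexified heat symbol -/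

namespace Literature.Analysis.UnboundedOperators

/-- On a real inner product space, the complexified heat symbol `ξ ↦ (heatSymbol t ξ : ℂ)` has
temperate growth for `0 ≤ t`, relative to the upstream named fact
`Literature.Analysis.UnboundedOperators.heatSymbol_hasTemperateGrowth` (temperate growth of the real symbol; Stein, *Singular
Integrals*, Ch. III §2) taken as the hypothesis `hE`; so it is an admissible Fourier multiplier
on `𝓢` and `𝓢'`. [folklore] -/
theorem heatSymbol_hasTemperateGrowth_complex {E : Type*} [NormedAddCommGroup E]
    [InnerProductSpace ℝ E] (hE : heatSymbol_hasTemperateGrowth (E := E)) {t : ℝ} (ht : 0 ≤ t) :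
    Function.HasTemperateGrowth (fun ξ : E => (heatSymbol t ξ : ℂ)) :=
  Complex.ofRealCLM.hasTemperateGrowth.comp (hE ht)

end Literature.Analysis.UnboundedOperators

/-! ### The heat semigroup on Schwartz space -/

namespace SchwartzMap

variable {E F : Type*} [NormedAddCommGroup E] [InnerProductSpace ℝ E] [FiniteDimensional ℝ E]
  [MeasurableSpace E] [BorelSpace E] [NormedAddCommGroup F] [NormedSpace ℂ F]

/-- (Dot-notation extension of Mathlib's `SchwartzMap`.) The **heat semigroup** `e^{tΔ}` on
Schwartz space `𝓢(E, F)`, defined as the Fourier multiplier with symbol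
`ξ ↦ exp (-(2π)² t ‖ξ‖²) = Literature.heatSymbol t ξ`. Junk for `t < 0` (symbol not of temperate
growth). All API lemmas below assume `[CompleteSpace F]`: Mathlib's
`SchwartzMap.fourierMultiplierCLM` is built from Bochner integrals and is junk for non-complete
`F` (the `𝓢'` versions do not need completeness).
Stein–Weiss, *Fourier Analysis on Euclidean Spaces*, Ch. I §1 (Gauss–Weierstrass
semigroup); Engel–Nagel (2000), Ch. II §2.13. [cite: EngelNagel2000] -/
def heatSemigroup (t : ℝ) : 𝓢(E, F) →L[ℂ] 𝓢(E, F) :=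
  fourierMultiplierCLM F (fun ξ : E => (Literature.Analysis.UnboundedOperators.heatSymbol t ξ : ℂ))

/-- Unfolding lemma: `e^{tΔ}` on `𝓢` is the Fourier multiplier with symbol `heatSymbol t`
(Stein–Weiss, Ch. I §1). [folklore] -/
theorem heatSemigroup_eq_fourierMultiplierCLM (t : ℝ) :
    (heatSemigroup t : 𝓢(E, F) →L[ℂ] 𝓢(E, F)) =
      fourierMultiplierCLM F (fun ξ : E => (Literature.Analysis.UnboundedOperators.heatSymbol t ξ : ℂ)) :=
  rfl

variable (E F) in
/-- The heat semigroup on `𝓢(E, F)`, `F` complete, is a C₀-semigroup: there is a (unique)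
strongly continuous semigroup `T` on the Fréchet space `𝓢(E, F)` with `T(t) = e^{tΔ}` for all
`t ≥ 0` (strong continuity in the Schwartz topology; Engel–Nagel (2000), Ch. II §2.13). Named
fact (no proof here), `E`, `F` explicit, completeness of `F` quantified inside. [cite: EngelNagel2000, Ch. II §2.13] -/
def exists_heatC0Semigroup : Prop :=
  ∀ [CompleteSpace F],
    ∃ T : Literature.Analysis.UnboundedOperators.C0Semigroup ℂ 𝓢(E, F), ∀ t : ℝ≥0, T.app t = heatSemigroup (t : ℝ)

variable [CompleteSpace F]

/-- `e^{0Δ} = 1` on `𝓢(E, F)`. Evans, *PDE*, §2.3; Engel–Nagel (2000), Ch. II §2.13. [cite: EngelNagel2000] -/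
theorem heatSemigroup_zero :
    (heatSemigroup 0 : 𝓢(E, F) →L[ℂ] 𝓢(E, F)) = 1 := by
  simp [heatSemigroup, ContinuousLinearMap.one_def]

/-- Semigroup law `e^{(s+t)Δ} = e^{sΔ} e^{tΔ}` on `𝓢(E, F)` for `0 ≤ s, t`
(via `fourierMultiplierCLM_fourierMultiplierCLM_apply` and `heatSymbol_add`), relative to the
named fact `Literature.Analysis.UnboundedOperators.heatSymbol_hasTemperateGrowth` (hypothesis `hE`).
Evans, *PDE*, §2.3; Engel–Nagel (2000), Ch. II §2.13. [cite: EngelNagel2000] -/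
theorem heatSemigroup_add (hE : Literature.Analysis.UnboundedOperators.heatSymbol_hasTemperateGrowth (E := E)) {s t : ℝ}
    (hs : 0 ≤ s) (ht : 0 ≤ t) :
    (heatSemigroup (s + t) : 𝓢(E, F) →L[ℂ] 𝓢(E, F)) = heatSemigroup s * heatSemigroup t := by
  rw [ContinuousLinearMap.mul_def, heatSemigroup, heatSemigroup, heatSemigroup,
    fourierMultiplierCLM_compL_fourierMultiplierCLM
      (Literature.Analysis.UnboundedOperators.heatSymbol_hasTemperateGrowth_complex hE hs)
      (Literature.Analysis.UnboundedOperators.heatSymbol_hasTemperateGrowth_complex hE ht)]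
  congr 1
  funext ξ
  simp [Literature.Analysis.UnboundedOperators.heatSymbol_add]

/-- `e^{tΔ}` commutes with the Laplacian on `𝓢(E, F)`, `0 ≤ t` (both are Fourier multipliers;
Stein–Weiss, Ch. I §1), relative to the named fact `Literature.Analysis.UnboundedOperators.heatSymbol_hasTemperateGrowth`
(hypothesis `hE`). [folklore] -/
theorem heatSemigroup_laplacian_comm (hE : Literature.Analysis.UnboundedOperators.heatSymbol_hasTemperateGrowth (E := E)) {t : ℝ}
    (ht : 0 ≤ t) (f : 𝓢(E, F)) :
    heatSemigroup t (Δ f) = Δ (heatSemigroup t f) := by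
  have h2 : Function.HasTemperateGrowth (fun x : E => ‖x‖ ^ 2) := by fun_prop
  rw [laplacian_eq_fourierMultiplierCLM, laplacian_eq_fourierMultiplierCLM,
    ContinuousLinearMap.map_smul_of_tower, heatSemigroup, ← fourierMultiplierCLM_ofReal ℂ h2,
    ← fourierMultiplierCLM_ofReal ℂ h2,
    fourierMultiplierCLM_fourierMultiplierCLM_apply
      (Literature.Analysis.UnboundedOperators.heatSymbol_hasTemperateGrowth_complex hE ht) (by fun_prop),
    fourierMultiplierCLM_fourierMultiplierCLM_apply (by fun_prop)
      (Literature.Analysis.UnboundedOperators.heatSymbol_hasTemperateGrowth_complex hE ht),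
    mul_comm (fun ξ : E => (Literature.Analysis.UnboundedOperators.heatSymbol t ξ : ℂ))]

end SchwartzMap

/-! ### The heat semigroup on tempered distributions -/

namespace TemperedDistribution

variable {E F : Type*} [NormedAddCommGroup E] [InnerProductSpace ℝ E] [FiniteDimensional ℝ E]
  [MeasurableSpace E] [BorelSpace E] [NormedAddCommGroup F] [NormedSpace ℂ F]

/-- (Dot-notation extension of Mathlib's `TemperedDistribution`.) The **heat semigroup** `e^{tΔ}`
on tempered distributions `𝓢'(E, F)`, the Fourier multiplier with symbol
`ξ ↦ exp (-(2π)² t ‖ξ‖²) = Literature.heatSymbol t ξ`. Junk for `t < 0` (symbol not of temperate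
growth). Stein–Weiss, *Fourier Analysis on Euclidean Spaces*, Ch. I §1; Evans, *PDE*, §2.3. [folklore] -/
def heatSemigroup (t : ℝ) : 𝓢'(E, F) →L[ℂ] 𝓢'(E, F) :=
  fourierMultiplierCLM F (fun ξ : E => (Literature.Analysis.UnboundedOperators.heatSymbol t ξ : ℂ))

/-- Unfolding lemma: `e^{tΔ}` on `𝓢'` is the Fourier multiplier with symbol `heatSymbol t`
(Stein–Weiss, Ch. I §1). [folklore] -/
theorem heatSemigroup_eq_fourierMultiplierCLM (t : ℝ) :
    (heatSemigroup t : 𝓢'(E, F) →L[ℂ] 𝓢'(E, F)) =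
      fourierMultiplierCLM F (fun ξ : E => (Literature.Analysis.UnboundedOperators.heatSymbol t ξ : ℂ)) :=
  rfl

/-- `e^{0Δ} = 1` on `𝓢'(E, F)`. Evans, *PDE*, §2.3. [folklore] -/
theorem heatSemigroup_zero :
    (heatSemigroup 0 : 𝓢'(E, F) →L[ℂ] 𝓢'(E, F)) = 1 := by
  simp [heatSemigroup, ContinuousLinearMap.one_def]

/-- Semigroup law `e^{(s+t)Δ} = e^{sΔ} e^{tΔ}` on `𝓢'(E, F)` for `0 ≤ s, t`, relative to the
named fact `Literature.Analysis.UnboundedOperators.heatSymbol_hasTemperateGrowth` (hypothesis `hE`).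
Evans, *PDE*, §2.3; Stein–Weiss, Ch. I §1. [folklore] -/
theorem heatSemigroup_add (hE : Literature.Analysis.UnboundedOperators.heatSymbol_hasTemperateGrowth (E := E)) {s t : ℝ}
    (hs : 0 ≤ s) (ht : 0 ≤ t) :
    (heatSemigroup (s + t) : 𝓢'(E, F) →L[ℂ] 𝓢'(E, F)) = heatSemigroup s * heatSemigroup t := by
  rw [ContinuousLinearMap.mul_def, heatSemigroup, heatSemigroup, heatSemigroup,
    fourierMultiplierCLM_compL_fourierMultiplierCLM
      (Literature.Analysis.UnboundedOperators.heatSymbol_hasTemperateGrowth_complex hE ht)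
      (Literature.Analysis.UnboundedOperators.heatSymbol_hasTemperateGrowth_complex hE hs)]
  congr 1
  funext ξ
  simp [Literature.Analysis.UnboundedOperators.heatSymbol_add, mul_comm]

/-- Compatibility with the embedding `𝓢 → 𝓢'`: `e^{tΔ} ↑f = ↑(e^{tΔ} f)` for a Schwartz function
`f` and `0 ≤ t` (Mathlib: `fourierMultiplierCLM_toTemperedDistributionCLM_eq`), relative to the
named fact `Literature.Analysis.UnboundedOperators.heatSymbol_hasTemperateGrowth` (hypothesis `hE`).
Stein–Weiss, Ch. I §3. [folklore] -/
theorem heatSemigroup_toTemperedDistributionCLM_comm [CompleteSpace F]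
    (hE : Literature.Analysis.UnboundedOperators.heatSymbol_hasTemperateGrowth (E := E)) {t : ℝ} (ht : 0 ≤ t) (f : 𝓢(E, F)) :
    heatSemigroup t (f : 𝓢'(E, F)) = (SchwartzMap.heatSemigroup t f : 𝓢'(E, F)) :=
  fourierMultiplierCLM_toTemperedDistributionCLM_eq
    (Literature.Analysis.UnboundedOperators.heatSymbol_hasTemperateGrowth_complex hE ht) f

/-- `e^{tΔ}` commutes with the distributional Laplacian on `𝓢'(E, F)`, `0 ≤ t`
(both are Fourier multipliers, `laplacian_eq_fourierMultiplierCLM`; Stein–Weiss, Ch. I §1),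
relative to the named fact `Literature.Analysis.UnboundedOperators.heatSymbol_hasTemperateGrowth` (hypothesis `hE`). [folklore] -/
theorem heatSemigroup_laplacian_comm (hE : Literature.Analysis.UnboundedOperators.heatSymbol_hasTemperateGrowth (E := E)) {t : ℝ}
    (ht : 0 ≤ t) (u : 𝓢'(E, F)) :
    heatSemigroup t (Δ u) = Δ (heatSemigroup t u) := by
  rw [laplacian_eq_fourierMultiplierCLM, laplacian_eq_fourierMultiplierCLM,
    ContinuousLinearMap.map_smul_of_tower, heatSemigroup,
    fourierMultiplierCLM_fourierMultiplierCLM_apply (by fun_prop)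
      (Literature.Analysis.UnboundedOperators.heatSymbol_hasTemperateGrowth_complex hE ht),
    fourierMultiplierCLM_fourierMultiplierCLM_apply
      (Literature.Analysis.UnboundedOperators.heatSymbol_hasTemperateGrowth_complex hE ht) (by fun_prop),
    mul_comm (fun ξ : E => (Literature.Analysis.UnboundedOperators.heatSymbol t ξ : ℂ))]

variable (E F) in
/-- The heat equation in `𝓢'`: for `t > 0` and every test function `φ`, the map
`s ↦ ⟨e^{sΔ} u, φ⟩` is differentiable at `s = t` with derivative `⟨Δ (e^{tΔ} u), φ⟩`, i.e.
`d/dt e^{tΔ} u = Δ e^{tΔ} u` in the weak-* sense. Named fact (no proof here), `E`, `F` explicit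
and `t`, `u`, `φ` quantified inside. Evans, *PDE*, §2.3.1, Theorem 1; Stein–Weiss, Ch. I §1,
Theorem 1.18. [cite: SteinWeiss1971, Ch. I Thm. 1.18] -/
def hasDerivAt_heatSemigroup : Prop :=
  ∀ ⦃t : ℝ⦄, 0 < t → ∀ (u : 𝓢'(E, F)) (φ : 𝓢(E, ℂ)),
    HasDerivAt (fun s : ℝ => heatSemigroup s u φ) (Δ (heatSemigroup t u) φ) t

end TemperedDistribution

/-! ### The bridge to the caloric extension of `L^p` functions -/

namespace MeasureTheory.Lp

variable {E F : Type*} [NormedAddCommGroup E] [InnerProductSpace ℝ E] [FiniteDimensional ℝ E]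
  [MeasurableSpace E] [BorelSpace E] [NormedAddCommGroup F] [NormedSpace ℂ F] [CompleteSpace F]

/-- (Dot-notation extension of Mathlib's `MeasureTheory.Lp`.) The caloric extension
`e^{tΔ} f = heatKernel t ⋆ f` of `f ∈ L^p`, `1 ≤ p`, is again in `L^p` for `0 < t`, relative to
the upstream named fact `Literature.Analysis.UnboundedOperators.memLp_heatExtension` (Giga–Giga–Saal, *Nonlinear PDEs*, §1.1.2)
taken as the hypothesis `hM`. [folklore] -/
theorem memLp_heatExtension (hM : Literature.Analysis.UnboundedOperators.memLp_heatExtension (E := E) (F := F)) {p : ℝ≥0∞}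
    [hp : Fact (1 ≤ p)] (f : Lp F p (volume : Measure E)) {t : ℝ} (ht : 0 < t) :
    MemLp (Literature.Analysis.UnboundedOperators.heatExtension (f : E → F) t) p (volume : Measure E) :=
  hM (Lp.memLp f) hp.out ht

variable (E F) in
/-- The Fourier-multiplier heat semigroup on `𝓢'` extends the kernel one on `L^p`: for
`f ∈ L^p(E, F)`, `1 ≤ p`, `0 < t`, the tempered distribution `e^{tΔ} ↑f` is (the distribution
of) the caloric extension `heatKernel t ⋆ f ∈ L^p` (the `L^p` membership being the named fact
`Literature.Analysis.UnboundedOperators.memLp_heatExtension`, quantified inside as `hM`). Named fact (no proof here), `E`, `F`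
explicit. Stein–Weiss, *Fourier Analysis on Euclidean Spaces*, Ch. I, Theorem 1.18 and §3;
Evans, *PDE*, §2.3.1. [cite: SteinWeiss1971, Ch. I Thm. 1.18 and §3] -/
def heatSemigroup_toTemperedDistribution_Lp : Prop :=
  ∀ (hM : Literature.Analysis.UnboundedOperators.memLp_heatExtension (E := E) (F := F)) ⦃p : ℝ≥0∞⦄ [Fact (1 ≤ p)]
    (f : Lp F p (volume : Measure E)) ⦃t : ℝ⦄ (ht : 0 < t),
    TemperedDistribution.heatSemigroup t (f : 𝓢'(E, F)) =
      (((memLp_heatExtension hM f ht).toLp _ : Lp F p (volume : Measure E)) : 𝓢'(E, F))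

end MeasureTheory.Lp

/-! ### The heat multiplier on the torus `𝕋ᵈ` -/

namespace Literature.Analysis.UnboundedOperators

/-- The **heat multiplier on the torus** `𝕋ᵈ`: the bounded sequence
`n ↦ exp (-(2π)² t |n|²)`, `|n|² = ∑ i, (n i)²`, indexed by the frequency lattice `ℤᵈ = d → ℤ`,
as an element of `ℓ^∞(ℤᵈ, ℂ)` (bounded by `1` since `0 ≤ t`). It is the symbol of `e^{tΔ}` in the
Fourier basis `e^{2πi n·x}` of `L²(𝕋ᵈ)`. Grafakos, *Classical Fourier Analysis*, §3.1–3.2;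
Stein–Weiss, Ch. VII §1. [folklore] -/
def torusHeatMultiplier (d : Type*) [Fintype d] (t : ℝ≥0) : lp (fun _ : d → ℤ => ℂ) ∞ :=
  ⟨fun n => (Real.exp (-(2 * π) ^ 2 * t * ∑ i, (n i : ℝ) ^ 2) : ℂ),
    memℓp_infty ⟨1, by
      rintro _ ⟨n, rfl⟩
      dsimp only
      rw [Complex.norm_real, Real.norm_eq_abs, Real.abs_exp, Real.exp_le_one_iff]
      have : 0 ≤ (2 * π) ^ 2 * (t : ℝ) * ∑ i, (n i : ℝ) ^ 2 := by positivity
      linarith⟩⟩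

variable {d : Type*} [Fintype d]

/-- The torus heat multiplier at frequency `n` is `exp (-(2π)² t |n|²)`
(Grafakos, *Classical Fourier Analysis*, §3.2). [folklore] -/
@[simp]
theorem torusHeatMultiplier_apply (t : ℝ≥0) (n : d → ℤ) :
    torusHeatMultiplier d t n = (Real.exp (-(2 * π) ^ 2 * t * ∑ i, (n i : ℝ) ^ 2) : ℂ) :=
  rfl

/-- The torus heat multiplier is bounded by `1` in modulus (Grafakos, §3.2). [folklore] -/
theorem norm_torusHeatMultiplier_apply_le_one (t : ℝ≥0) (n : d → ℤ) :
    ‖torusHeatMultiplier d t n‖ ≤ 1 := by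
  rw [torusHeatMultiplier_apply, Complex.norm_real, Real.norm_eq_abs, Real.abs_exp,
    Real.exp_le_one_iff]
  have : 0 ≤ (2 * π) ^ 2 * (t : ℝ) * ∑ i, (n i : ℝ) ^ 2 := by positivity
  linarith

/-- `‖torusHeatMultiplier d t‖_∞ ≤ 1` (Grafakos, §3.2). [folklore] -/
theorem norm_torusHeatMultiplier_le_one (t : ℝ≥0) : ‖torusHeatMultiplier d t‖ ≤ 1 :=
  lp.norm_le_of_forall_le zero_le_one (norm_torusHeatMultiplier_apply_le_one t)

/-- The torus heat multiplier is real: `star m = m` (Grafakos, §3.2). [folklore] -/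
theorem isSelfAdjoint_torusHeatMultiplier (t : ℝ≥0) : IsSelfAdjoint (torusHeatMultiplier d t) := by
  ext n
  simp only [lp.star_apply, torusHeatMultiplier_apply, RCLike.star_def, Complex.conj_ofReal]

/-- At time `0` the torus heat multiplier is `1` (Grafakos, §3.2). [folklore] -/
@[simp]
theorem torusHeatMultiplier_zero : torusHeatMultiplier d 0 = 1 := by
  ext n
  simp [lp.infty_coeFn_one]

/-- Semigroup law for the torus heat multiplier: `m_{s+t} = m_s m_t` in `ℓ^∞`
(Grafakos, §3.2). [folklore] -/
theorem torusHeatMultiplier_add (s t : ℝ≥0) :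
    torusHeatMultiplier d (s + t) = torusHeatMultiplier d s * torusHeatMultiplier d t := by
  ext n
  simp only [torusHeatMultiplier_apply, lp.infty_coeFn_mul, Pi.mul_apply, NNReal.coe_add,
    ← Complex.ofReal_mul, ← Real.exp_add]
  congr 2
  ring

end Literature.Analysis.UnboundedOperators

/-! ### The heat semigroup on a Hilbert space with a `ℤᵈ`-indexed Hilbert basis -/

namespace HilbertBasis

open Literature.Analysis.UnboundedOperators

variable {d X : Type*} [Fintype d] [NormedAddCommGroup X] [InnerProductSpace ℂ X]
variable (b : HilbertBasis (d → ℤ) ℂ X)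

/-- (Dot-notation extension of Mathlib's `HilbertBasis`.) The **heat semigroup on the torus**
in a Hilbert basis `b` indexed by `ℤᵈ` (e.g. the Fourier basis of `L²(𝕋ᵈ)`): the bounded
diagonal operator `b n ↦ exp (-(2π)² t |n|²) b n`, i.e. `b.diagonalCLM (torusHeatMultiplier d t)`.
Grafakos, *Classical Fourier Analysis*, §3.2; Stein–Weiss, Ch. VII §1. [folklore] -/
def torusHeatSemigroup (t : ℝ≥0) : X →L[ℂ] X :=
  b.diagonalCLM (torusHeatMultiplier d t)

/-- Unfolding lemma: `b.torusHeatSemigroup t = b.diagonalCLM (torusHeatMultiplier d t)`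
(Grafakos, §3.2). [folklore] -/
theorem torusHeatSemigroup_eq_diagonalCLM (t : ℝ≥0) :
    b.torusHeatSemigroup t = b.diagonalCLM (torusHeatMultiplier d t) :=
  rfl

/-- `e^{0Δ} = 1` on the torus (Grafakos, §3.2). [folklore] -/
@[simp]
theorem torusHeatSemigroup_zero : b.torusHeatSemigroup 0 = 1 := by
  simp [torusHeatSemigroup]

/-- Semigroup law `e^{(s+t)Δ} = e^{sΔ} e^{tΔ}` on the torus (Grafakos, §3.2). [folklore] -/
theorem torusHeatSemigroup_add (s t : ℝ≥0) :
    b.torusHeatSemigroup (s + t) = b.torusHeatSemigroup s * b.torusHeatSemigroup t := by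
  simp [torusHeatSemigroup, torusHeatMultiplier_add, diagonalCLM_mul]

/-- The torus heat semigroup is a contraction: `‖e^{tΔ}‖ ≤ 1` (Grafakos, §3.2;
Stein–Weiss, Ch. VII §1). [folklore] -/
theorem norm_torusHeatSemigroup_le_one (t : ℝ≥0) : ‖b.torusHeatSemigroup t‖ ≤ 1 :=
  (b.norm_diagonalCLM_le _).trans (norm_torusHeatMultiplier_le_one t)

/-- The basis vectors are eigenvectors: `e^{tΔ} (b n) = exp (-(2π)² t |n|²) • b n`
(Grafakos, *Classical Fourier Analysis*, §3.2: `e^{tΔ} e^{2πi n·x} = e^{-4π²t|n|²} e^{2πi n·x}`). [folklore] -/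
theorem torusHeatSemigroup_basis (t : ℝ≥0) (n : d → ℤ) :
    b.torusHeatSemigroup t (b n) =
      (Real.exp (-(2 * π) ^ 2 * t * ∑ i, (n i : ℝ) ^ 2) : ℂ) • b n :=
  b.diagonalCLM_basis _ n

/-- The torus heat semigroup consists of self-adjoint operators (real symbol;
Grafakos, §3.2). [folklore] -/
theorem isSelfAdjoint_torusHeatSemigroup [CompleteSpace X] (t : ℝ≥0) :
    IsSelfAdjoint (b.torusHeatSemigroup t) := by
  rw [IsSelfAdjoint, ContinuousLinearMap.star_eq_adjoint, torusHeatSemigroup,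
    adjoint_diagonalCLM, (isSelfAdjoint_torusHeatMultiplier t).star_eq]

/-- The torus heat semigroup is a C₀-semigroup on `X`: there is a (unique) strongly continuous
semigroup `T` with `T(t) = b.torusHeatSemigroup t` for all `t ≥ 0` (strong continuity by
dominated convergence in `ℓ²`; Engel–Nagel (2000), Ch. I §4.a, multiplication semigroups).
Named fact (no proof here), for the given basis `b`. [cite: EngelNagel2000, Ch. I §4.a] -/
def exists_torusHeatC0Semigroup : Prop :=
  ∃ T : C0Semigroup ℂ X, ∀ t : ℝ≥0, T.app t = b.torusHeatSemigroup t

end HilbertBasis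

/-! ### Discharge of `HilbertBasis.exists_torusHeatC0Semigroup`

The torus heat semigroup is the multiplication semigroup `e^{tq}`, `q(n) = -(2π)² |n|² ≤ 0`, on
`ℓ²(ℤᵈ)` transported along `b.repr`; it is a contraction semigroup, and its strong continuity is
obtained as in Engel–Nagel: orbits of the dense subspace spanned by the basis vectors are finite
sums of continuous scalar functions times fixed vectors, and `‖e^{tΔ}‖ ≤ 1` makes every orbit a
uniform limit of such (Engel–Nagel (2000), Ch. I §4 (multiplication semigroups) and §5 (Def. 5.1,
Prop. 5.3); the same material, with the numbering quoted below, in Engel–Nagel, *A Short Course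
on Operator Semigroups* (2006), Ch. I: Def. 1.1, p. 5; Lemma 1.2, p. 6; Prop. 1.3, p. 7;
Prop. 3.11, p. 26). No new definition is introduced: the C₀-semigroup is assembled inside the
proof of `exists_torusHeatC0Semigroup_holds` from `torusHeatSemigroup_zero`,
`torusHeatSemigroup_add` and `continuous_torusHeatSemigroup_apply`. -/

namespace Literature.Analysis.UnboundedOperators

variable {d : Type*} [Fintype d]

/-- Each entry `t ↦ exp (-(2π)² t |n|²)` of the torus heat multiplier is continuous in `t ∈ ℝ≥0`
(the scalar semigroups `t ↦ e^{tq(n)}` making up a multiplication semigroup; Engel–Nagel,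
*Short Course* (2006), Ch. I §3, Example 3.7 (iii), p. 24: `T(t)(x_n) = (e^{-n²t} x_n)`).
[folklore] -/
theorem continuous_torusHeatMultiplier_apply (n : d → ℤ) :
    Continuous fun t : ℝ≥0 => torusHeatMultiplier d t n := by
  simp only [torusHeatMultiplier_apply]
  fun_prop

end Literature.Analysis.UnboundedOperators

namespace HilbertBasis

open Literature.Analysis.UnboundedOperators

variable {d X : Type*} [Fintype d] [NormedAddCommGroup X] [InnerProductSpace ℂ X]
variable (b : HilbertBasis (d → ℤ) ℂ X)

/-- Orbits of finite linear combinations of basis vectors under the torus heat semigroup are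
continuous: for `v = ∑_{n ∈ s} c n • b n`,
`t ↦ e^{tΔ} v = ∑_{n ∈ s} c n • exp (-(2π)² t |n|²) • b n` is a finite sum of continuous scalar
functions times fixed vectors (the dense set of "nice" elements on which strong continuity is
checked; Engel–Nagel, *Short Course* (2006), Ch. I Prop. 1.3 and the remark after its proof,
p. 7). [cite: EngelNagel2006, Ch. I Prop. 1.3] -/
theorem continuous_torusHeatSemigroup_finsetSum (s : Finset (d → ℤ)) (c : (d → ℤ) → ℂ) :
    Continuous fun t : ℝ≥0 => b.torusHeatSemigroup t (∑ n ∈ s, c n • b n) := by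
  simp only [map_sum, map_smul, torusHeatSemigroup_basis]
  exact continuous_finsetSum s fun n _ =>
    ((continuous_torusHeatMultiplier_apply n).smul continuous_const).const_smul (c n)

/-- **Strong continuity of the torus heat semigroup**: every orbit `t ↦ e^{tΔ} v`, `v ∈ X`, is
continuous on `ℝ≥0`. Proof as in Engel–Nagel: `‖e^{tΔ}‖ ≤ 1` for all `t`
(`norm_torusHeatSemigroup_le_one`) and the orbits of the partial sums of the Fourier expansion
`v = ∑ ⟪b n, v⟫ b n` (`HilbertBasis.hasSum_repr`, a dense set) are continuous
(`continuous_torusHeatSemigroup_finsetSum`), so every orbit is a uniform limit of continuous maps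
(Engel–Nagel (2000), Ch. I §5, Prop. 5.3 (c) ⇒ (a), and §4, multiplication semigroups; *Short
Course* (2006), Ch. I Lemma 1.2 (b) ⇒ (a), p. 6, Prop. 1.3 (c) ⇒ (a), p. 7, and Prop. 3.11, p. 26:
the multiplication semigroup `T_q(t) f = e^{tq} f` on `L^p(Ω, μ)` with `ess sup Re q < ∞` is
strongly continuous; here `Ω = ℤᵈ` with counting measure, `p = 2`, `q(n) = -(2π)² |n|² ≤ 0`).
[cite: EngelNagel2006, Ch. I Lemma 1.2 and Prop. 3.11] -/
theorem continuous_torusHeatSemigroup_apply (v : X) :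
    Continuous fun t : ℝ≥0 => b.torusHeatSemigroup t v := by
  refine continuous_of_uniform_approx_of_continuous fun u hu => ?_
  obtain ⟨ε, hε, hεu⟩ := Metric.mem_uniformity_dist.mp hu
  obtain ⟨s, hs⟩ := ((b.hasSum_repr v).eventually (Metric.ball_mem_nhds v hε)).exists
  refine ⟨fun t => b.torusHeatSemigroup t (∑ n ∈ s, b.repr v n • b n),
    b.continuous_torusHeatSemigroup_finsetSum s _, fun t => hεu ?_⟩
  rw [dist_eq_norm, ← map_sub]
  calc ‖b.torusHeatSemigroup t (v - ∑ n ∈ s, b.repr v n • b n)‖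
      ≤ ‖b.torusHeatSemigroup t‖ * ‖v - ∑ n ∈ s, b.repr v n • b n‖ :=
        (b.torusHeatSemigroup t).le_opNorm _
    _ ≤ 1 * ‖v - ∑ n ∈ s, b.repr v n • b n‖ := by
        gcongr
        exact b.norm_torusHeatSemigroup_le_one t
    _ < ε := by
        rw [one_mul, ← dist_eq_norm, dist_comm]
        exact hs

/-- Discharge of the named fact `exists_torusHeatC0Semigroup`: the torus heat semigroup
`t ↦ b.torusHeatSemigroup t = b.diagonalCLM (torusHeatMultiplier d t)` is (the operator family
of) a C₀-semigroup on `X`. The monoid homomorphism `Multiplicative ℝ≥0 →* (X →L[ℂ] X)` is the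
functional equation `torusHeatSemigroup_zero` / `torusHeatSemigroup_add`; strong continuity is
`continuous_torusHeatSemigroup_apply` (Engel–Nagel (2000), Ch. I Def. 5.1, Prop. 5.3 and §4,
multiplication semigroups; *Short Course* (2006), Ch. I Def. 1.1, p. 5, Prop. 1.3, p. 7, and
Prop. 3.11, p. 26, strong continuity of `e^{tq}` on `L^p(Ω, μ)`, here `ℓ²(ℤᵈ)`).
[cite: EngelNagel2000, Ch. I §4.a] [cite: EngelNagel2006, Ch. I Prop. 1.3 and Prop. 3.11] -/
theorem exists_torusHeatC0Semigroup_holds : b.exists_torusHeatC0Semigroup :=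
  ⟨{ toMonoidHom :=
      { toFun := fun t => b.torusHeatSemigroup (Multiplicative.toAdd t)
        map_one' := by simp
        map_mul' := fun s t => by simp [toAdd_mul, torusHeatSemigroup_add] }
     strongly_continuous := fun v =>
       (b.continuous_torusHeatSemigroup_apply v).comp continuous_toAdd },
    fun _ => rfl⟩

end HilbertBasis
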